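import Literature.NumberTheory.Automorphic.CompletedCohomology
import Literature.NumberTheory.Automorphic.CompletedCohomologyHeckeAlgebraGLn
import HarnessLib

/-!
# Completed cohomology of `GL_n` over a number field

Topic `NumberTheory/Automorphic`, namespace `Literature.NumberTheory.Automorphic.BigHeckeGLn`
(the grouping namespace of `CompletedCohomologyHeckeAlgebraGLn`, which this file extends).

`CompletedCohomologyHeckeAlgebraGLn` constructs, for an `S`-good tame level datum
`𝒰 : TameLevel n K p` of `GL_n` over a number field `K`, the cohomology
`levelCohomology U k i = H^i(X_U, k)` of Scholze's stacky arithmetic quotients (group cohomology of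
`GL_n(K)` with coefficients `Module.Dual k k[GL_n(𝔸_K^∞)/U]`), its Hecke operators, the `p`-power
tower `𝒰.tower` and the big Hecke algebra `𝕋(K^p) = CompletedCohomologyHeckeAlgebraGLn 𝒰`, and
defers Emerton's completed cohomology `H̃^i` itself to the present item.  The generic
construction of `H̃^i` lives in `CompletedCohomology` (for any `ι : Γ →* 𝒢` and `LevelTower`); this
file instantiates it for `GL_n / K` WITH THE VOCABULARY OF THAT FILE and proves that the two
finite-level cohomology theories agree:

* `funEquivLevelModule U k : Fun(GL_n(𝔸_K^∞)/U, k) ≃ₗ[k] levelModule U k` (a functional on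
  `k[G/U]` is its values on the basis), `coeffRepIso` (it is `GL_n(K)`-equivariant:
  `ArithmeticQuotient.coeffRep k (globalEmbedding n K) U k ≅ Rep.of (levelRep U k)`), hence
  **`levelCohomologyIso U k i : ArithmeticQuotient.cohomology k (globalEmbedding n K) U k i ≅
  levelCohomology U k i`**, and the Hecke operators correspond:
  `funEquivLevelModule_heckeFun` (`ArithmeticQuotient.heckeFun` ↔ `BigHeckeGLn.heckeEnd`, both
  being `(T_g f)(xU) = ∑_{yU ⊆ UgU} f(x y U)` with the same representative `x = (xU).out`) and
  `heckeOperator_comp_levelCohomologyIso_hom` (on `H^i`).  So there is ONE cohomology of `X_U`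
  in the tree up to this explicit isomorphism, and ONE big Hecke algebra of `GL_n`, namely
  `CompletedCohomologyHeckeAlgebraGLn 𝒰` (the generic `bigHeckeAlgebra` of `CompletedCohomology`
  is not re-instantiated here under a `GL_n` name).
* `TameLevel.levelTower 𝒰 : LevelTower` (the tower `𝒰.tower`, antitone by `tower_antitone`);
* **`TameLevel.completedCohomology 𝒰 k i = H̃^i(K^p)_k := lim_t colim_r H^i(X_{U_r}, k/p^t)`**,
  Emerton's `p`-adically completed cohomology of tame level `𝒰` with coefficients in a ring `k`
  (`ℤ`, `ℤ_p`, `𝒪_E`, …) [Emerton2006, §2.2], [CalegariEmerton2011, §§1, 5] — for `n = 2` and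
  `K` imaginary quadratic the completed cohomology of the Bianchi tower —, with its finite stages
  `TameLevel.completedCohomologyMod 𝒰 k i t = H̃^i(k/p^t)`;
* `TameLevel.SphericalIndex 𝒰` (`v ∉ S`, `1 ≤ i ≤ n`) with `elt = heckeElement n K v i = t_{v,i}`,
  and **`TameLevel.EigensystemOccurs 𝒰 k a i`**: the system of eigenvalues `T_{v,i} ↦ a v i`
  occurs in `H̃^i(K^p)_k`, i.e. for every `t` some `H^i(X_{U_r}, k/p^{t+1})` carries a simultaneous
  eigenclass with these eigenvalues and exact annihilator `(p^{t+1})` (torsion classes allowed)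
  — the generic `EigensystemOccurs` of `CompletedCohomology`; `eigensystemOccurs_iff` unfolds it.
  The characteristic-`0` / `Spf`-point notions for `GL_n` are `TameLevel.IsPadicallyAutomorphic`,
  `TameLevel.IsPointOver` of `CompletedCohomologyHeckeAlgebraGLn` (and, generically, `IsHeckePoint`).

NOT here: the `GL_n(K_p)`-action on `H̃^i`; tower-compatibility (`IsTowerCompatible`) of the
`t_{v,i}`, `v ∉ S`, hence their action on `H̃^i` (the factorizability fields of `TameLevel` are the
hypotheses it needs); the comparison of `H̃^i` for `k = ℤ` with `ZMod (p^t)`-coefficients used by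
`CompletedCohomologyHeckeAlgebraGLn` (`ℤ/p^tℤ ≅ ZMod (p^t)`); Galois representations.

## References

* M. Emerton, Invent. Math. 164 (2006), §2.2 [Emerton2006].
* F. Calegari, M. Emerton, *Completed cohomology — a survey* (2012), §§1, 5 [CalegariEmerton2011].
* P. Scholze, Ann. of Math. 182 (2015), §V.4 [Scholze2015].
-/

noncomputable section

open CategoryTheory
open scoped NumberField
open IsDedekindDomain

namespace Literature.NumberTheory.Automorphic

namespace BigHeckeGLn

variable {n : ℕ} {K : Type} [Field K] [NumberField K]

/-! ### `Fun(G/U, k)` versus `Dual k[G/U]`: the two cohomologies of `X_U` agree -/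

section Comparison

variable (U : Subgroup (FiniteAdelicGL n K)) (k : Type) [CommRing k]

/-- `Fun(GL_n(𝔸_K^∞)/U, k) ≃ₗ[k] Module.Dual k (k[GL_n(𝔸_K^∞)/U])`: a `k`-linear functional on the
permutation module is determined by (and freely prescribed on) the basis of cosets
(`MonoidAlgebra.basis`, `Module.Basis.constr`). [folklore] -/
def funEquivLevelModule : ((FiniteAdelicGL n K ⧸ U) → k) ≃ₗ[k] levelModule U k :=
  (MonoidAlgebra.basis (FiniteAdelicGL n K ⧸ U) k).constr k

/-- The functional attached to `F` takes the value `F c` on the basis vector `[c]`. [folklore] -/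
@[simp]
theorem funEquivLevelModule_apply_single (F : (FiniteAdelicGL n K ⧸ U) → k)
    (c : FiniteAdelicGL n K ⧸ U) :
    funEquivLevelModule U k F (MonoidAlgebra.single c 1) = F c := by
  rw [← MonoidAlgebra.basis_apply k c]
  exact (MonoidAlgebra.basis _ k).constr_basis k F c

/-- The inverse identification: `f ↦ (c ↦ f [c])`. [folklore] -/
theorem funEquivLevelModule_symm_apply (f : levelModule U k) (c : FiniteAdelicGL n K ⧸ U) :
    (funEquivLevelModule U k).symm f c = f (MonoidAlgebra.single c 1) := by
  conv_rhs => rw [← (funEquivLevelModule U k).apply_symm_apply f]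
  rw [funEquivLevelModule_apply_single]

/-- `funEquivLevelModule` intertwines the left-translation representation of `GL_n(K)` on
functions (`ArithmeticQuotient.coeffRepresentation`) with `levelRep` (the dual of the permutation
representation). [folklore] -/
theorem funEquivLevelModule_coeffRepresentation (γ : GL (Fin n) K)
    (F : (FiniteAdelicGL n K ⧸ U) → k) :
    funEquivLevelModule U k (ArithmeticQuotient.coeffRepresentation k (globalEmbedding n K) U k γ F) =
      levelRep U k γ (funEquivLevelModule U k F) := by
  refine MonoidAlgebra.lhom_ext' fun c => LinearMap.ext fun r => ?_
  simp only [LinearMap.comp_apply, MonoidAlgebra.lsingle_apply]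
  rw [show MonoidAlgebra.single c r = r • MonoidAlgebra.single c (1 : k) by
      rw [MonoidAlgebra.smul_single', mul_one], map_smul, map_smul,
    funEquivLevelModule_apply_single, levelRep_apply, LinearMap.comp_apply,
    Representation.ofMulAction_single, funEquivLevelModule_apply_single,
    ArithmeticQuotient.coeffRepresentation_apply]

/-- The isomorphism of `GL_n(K)`-representations
`Fun(GL_n(𝔸_K^∞)/U, k) ≅ Dual k[GL_n(𝔸_K^∞)/U]` (`ArithmeticQuotient.coeffRep` of the diagonal
embedding versus `levelRep`). [folklore] -/
def coeffRepIso : ArithmeticQuotient.coeffRep k (globalEmbedding n K) U k ≅ Rep.of (levelRep U k) :=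
  Rep.mkIso (Representation.Equiv.mk (funEquivLevelModule U k) fun γ =>
    LinearMap.ext fun F => funEquivLevelModule_coeffRepresentation U k γ F)

/-- **The two cohomologies of `X_U` agree**: `H^i(GL_n(K), Fun(GL_n(𝔸_K^∞)/U, k))`
(`ArithmeticQuotient.cohomology`, this development) is canonically isomorphic to
`levelCohomology U k i` of `CompletedCohomologyHeckeAlgebraGLn`. [folklore] -/
def levelCohomologyIso (i : ℕ) :
    ArithmeticQuotient.cohomology k (globalEmbedding n K) U k i ≅ levelCohomology U k i :=
  (groupCohomology.functor k (GL (Fin n) K) i).mapIso (coeffRepIso U k)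

variable [IsHeckeTriple (⊤ : Submonoid (FiniteAdelicGL n K)) U U]

/-- **The Hecke operators agree on functions**: under `funEquivLevelModule`, the double-coset
operator `ArithmeticQuotient.heckeFun k U g k` (`(T_g F)(xU) = ∑_{d ∈ UgU/U} F(x̃ • d)`) is the
transpose `BigHeckeGLn.heckeEnd U k g` of the tree's `heckeAlgebra.doubleCosetOperator U g`
(both use the representative `x̃ = (xU).out`; for a Hecke pair the orbit `UgU/U` is finite,
`finite_orbit_quotient`). [folklore] -/
theorem funEquivLevelModule_heckeFun (g : FiniteAdelicGL n K) (F : (FiniteAdelicGL n K ⧸ U) → k) :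
    funEquivLevelModule U k (ArithmeticQuotient.heckeFun k U g k F) =
      heckeEnd U k g (funEquivLevelModule U k F) := by
  refine MonoidAlgebra.lhom_ext' fun c => LinearMap.ext fun r => ?_
  simp only [LinearMap.comp_apply, MonoidAlgebra.lsingle_apply]
  rw [show MonoidAlgebra.single c r = r • MonoidAlgebra.single c (1 : k) by
      rw [MonoidAlgebra.smul_single', mul_one], map_smul, map_smul,
    funEquivLevelModule_apply_single, heckeEnd_apply, LinearMap.comp_apply,
    heckeAlgebra.apply_eq_extend_toVector, heckeAlgebra.toVector_doubleCosetOperator,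
    heckeAlgebra.extend_single, one_smul, heckeAlgebra.doubleCosetIndicator_eq_sum, map_sum, map_sum,
    ArithmeticQuotient.heckeFun_apply,
    dif_pos (show (ArithmeticQuotient.doubleCosetQuot U g).Finite from finite_orbit_quotient U g)]
  simp only [Representation.ofMulAction_single, funEquivLevelModule_apply_single]
  rfl

/-- The Hecke operators agree as endomorphisms of the `GL_n(K)`-representations. [folklore] -/
theorem heckeRepHom_comp_coeffRepIso_hom (g : FiniteAdelicGL n K) :
    ArithmeticQuotient.heckeRepHom k U g k (globalEmbedding n K) ≫ (coeffRepIso U k).hom =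
      (coeffRepIso U k).hom ≫ Rep.ofHom (heckeIntertwining U k g) :=
  Rep.hom_ext (Representation.IntertwiningMap.ext (LinearMap.ext fun F =>
    funEquivLevelModule_heckeFun U k g F))

/-- **The Hecke operators agree on `H^i(X_U, k)`**: `levelCohomologyIso` carries
`ArithmeticQuotient.heckeOperator` (= `heckeEnd`) to `BigHeckeGLn.heckeOnCohomology`. [folklore] -/
theorem heckeOperator_comp_levelCohomologyIso_hom (g : FiniteAdelicGL n K) (i : ℕ) :
    ArithmeticQuotient.heckeOperator k U g k (globalEmbedding n K) i ≫ (levelCohomologyIso U k i).hom =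
      (levelCohomologyIso U k i).hom ≫ ModuleCat.ofHom (heckeOnCohomology U k g i) := by
  change (groupCohomology.functor k (GL (Fin n) K) i).map _ ≫
      (groupCohomology.functor k (GL (Fin n) K) i).map _ =
    (groupCohomology.functor k (GL (Fin n) K) i).map _ ≫
      (groupCohomology.functor k (GL (Fin n) K) i).map _
  rw [← Functor.map_comp, ← Functor.map_comp, heckeRepHom_comp_coeffRepIso_hom]

end Comparison

/-! ### Completed cohomology of tame level `𝒰` -/

namespace TameLevel

variable {p : ℕ} [Fact p.Prime] (𝒰 : TameLevel n K p)

/-- The `p`-power tower `U_0 ≥ U_1 ≥ ⋯` of `𝒰` as a `LevelTower` (antitone by `tower_antitone`).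
[folklore] -/
def levelTower : LevelTower (FiniteAdelicGL n K) :=
  ⟨𝒰.tower, 𝒰.tower_antitone⟩

/-- The levels of `levelTower` are the `U_r` (definitional). [folklore] -/
@[simp]
theorem levelTower_level (r : ℕ) : 𝒰.levelTower.level r = 𝒰.tower r :=
  rfl

variable (k : Type) [CommRing k]

/-- **Emerton's `p`-adically completed cohomology of `GL_n / K` of tame level `𝒰` with
coefficients in `k`**: `H̃^i(K^p)_k := lim_t colim_r H^i(X_{U_r}, k/p^t)` along the `p`-power tower
of `𝒰` ([Emerton2006, §2.2]; [CalegariEmerton2011, §1 with the tower of §5]; Scholze's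
`H̃^i_{K^p}(ℤ_p)` for `k = ℤ`), a `k`-submodule of `Π_t H̃^i(k/p^t)` — the generic
`completedCohomology` for `ι = globalEmbedding n K`, `T = 𝒰.levelTower`, `ϖ = p`.
[cite: CalegariEmerton2011, §1 and §5] -/
abbrev completedCohomology (i : ℕ) :
    Submodule k (∀ t, Literature.NumberTheory.Automorphic.completedCohomologyMod k
      (globalEmbedding n K) 𝒰.levelTower (p : k) i t) :=
  Literature.NumberTheory.Automorphic.completedCohomology k (globalEmbedding n K) 𝒰.levelTower
    (p : k) i

/-- The finite stage `H̃^i(K^p)(k/p^t) = colim_r H^i(X_{U_r}, k/p^t)` (Scholze's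
`H̃^i_{K^p}(ℤ/p^n)`, [Scholze2015, Ch. IV intro]). [cite: CalegariEmerton2011, §1] -/
abbrev completedCohomologyMod (i t : ℕ) : Type :=
  Literature.NumberTheory.Automorphic.completedCohomologyMod k (globalEmbedding n K) 𝒰.levelTower
    (p : k) i t

variable {k} in
/-- The structure map `H^i(X_{U_r}, k/p^t) → H̃^i(K^p)(k/p^t)` from level `r` of the tower.
[folklore] -/
abbrev toCompletedCohomologyMod (i r t : ℕ) :
    ArithmeticQuotient.cohomology k (globalEmbedding n K) (𝒰.tower r) (modPow k (p : k) t) i →ₗ[k]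
      𝒰.completedCohomologyMod k i t :=
  Literature.NumberTheory.Automorphic.toCompletedCohomologyMod k (globalEmbedding n K)
    𝒰.levelTower (p : k) i r t

/-! ### Systems of Hecke eigenvalues occurring in `H̃^i` -/

/-- The **indices of the spherical Hecke operators `T_{v,i}` of tame level `𝒰`**: a good place
`v ∉ S` and `1 ≤ i ≤ n`.  (Among the `heckeGenerators` of `𝕋(K^p)` we omit `T_{v,0} = [U] = 1`,
whose eigenvalue condition would just force `a v 0 = 1`, the `T_{v,i} = T_{v,n}` for `i > n`, and
`T_{v,n}⁻¹`, whose eigenvalue is determined by that of `T_{v,n}`.) [folklore] -/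
structure SphericalIndex where
  /-- the place -/
  v : IsDedekindDomain.HeightOneSpectrum (𝓞 K)
  not_mem : v ∉ 𝒰.bad
  /-- which `T_{v,i}`, `1 ≤ i ≤ n` -/
  i : ℕ
  one_le : 1 ≤ i
  le : i ≤ n

/-- The Hecke element `t_{v,i} = heckeElement n K v i` of a spherical index. [folklore] -/
def SphericalIndex.elt (x : 𝒰.SphericalIndex) : FiniteAdelicGL n K :=
  heckeElement n K x.v x.i

variable {k} in
/-- The eigenvalue `a v i` prescribed at the index `(v, i)` by a family
`a : (place) → (i) → k` of putative `T_{v,i}`-eigenvalues. [folklore] -/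
def SphericalIndex.eval (a : IsDedekindDomain.HeightOneSpectrum (𝓞 K) → ℕ → k)
    (x : 𝒰.SphericalIndex) : k :=
  a x.v x.i

/-- **The system of Hecke eigenvalues `T_{v,i} ↦ a v i` (`v ∉ S`, `1 ≤ i ≤ n`) occurs in the
completed cohomology `H̃^i(K^p)_k` of tame level `𝒰`**: for every `t` there are a level `U_r` of the
`p`-power tower and a simultaneous eigenclass `c ∈ H^i(X_{U_r}, k/p^{t+1})`,
`T_{v,i} c = a v i • c`, whose annihilator in `k` is exactly `(p^{t+1})` (torsion classes allowed,
no lifting to characteristic `0` required) — the generic `EigensystemOccurs`.  (By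
`EigensystemOccurs.isHeckePoint` of `CompletedCohomologyPoints` such an `a` is a `k`-point of the
generic big Hecke algebra mod `p^t` for every `t`.) [cite: CalegariEmerton2011, §8] -/
abbrev EigensystemOccurs (a : IsDedekindDomain.HeightOneSpectrum (𝓞 K) → ℕ → k) (i : ℕ) : Prop :=
  Literature.NumberTheory.Automorphic.EigensystemOccurs (globalEmbedding n K) 𝒰.levelTower (p : k)
    (SphericalIndex.elt 𝒰) (SphericalIndex.eval 𝒰 a) i

/-- Unfolding `EigensystemOccurs`. [folklore] -/
theorem eigensystemOccurs_iff (a : IsDedekindDomain.HeightOneSpectrum (𝓞 K) → ℕ → k) (i : ℕ) :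
    𝒰.EigensystemOccurs k a i ↔ ∀ t : ℕ, ∃ (r : ℕ)
      (c : ArithmeticQuotient.cohomology k (globalEmbedding n K) (𝒰.tower r)
        (modPow k (p : k) (t + 1)) i),
      (c ≠ 0 ∧ ∀ x : 𝒰.SphericalIndex,
        ArithmeticQuotient.heckeEnd k (𝒰.tower r) (heckeElement n K x.v x.i)
          (modPow k (p : k) (t + 1)) (globalEmbedding n K) i c = a x.v x.i • c) ∧
      ∀ b : k, b • c = 0 → b ∈ Ideal.span {(p : k) ^ (t + 1)} :=
  Iff.rfl

end TameLevel

end BigHeckeGLn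

end Literature.NumberTheory.Automorphic
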